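import Summits.MatrixMultiplication.OmegaCensus.STPPVosperSlackOneTools
/-!
# ω-census (abelian STPP census): K1 `{(1,1,2),(2,2,3),(3,4,2)²} ⊄ ℤ₆₁` — window tables (γ, β) and the word target (kernel computations)

HONEST FRAMING (pub-omega census; verbatim): lottery ticket; floor = certified bounds/negative ranges.
Census STRUCTURE (seat pub-omega-stpp-1 gen 32, 2026-08-28), family (b2).  The case-γ window table `(42, 18, 3)`, the case-β table `tableBeta 61 43 18 3` (survivors `30, 31` in both) and the word-target lemma for the K1 kill (`STPPVosperCoverKillK1Z61.lean`).  Nothing here is progress on `ω`.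
-/

open Finset

namespace Summit.MatrixMultiplication.OmegaCensus.CubeNB

/-- Tight-type (case γ) window table `(n, m, b) = (42, 18, 3)` at `61`: survivors `30, 31` beyond the words. [folklore] -/
theorem table61_42_18_3_K1 : ∀ j < 61, ∀ t < 61, (∀ i' < 18, (t + j * i') % 61 < 42) →
    (∀ k < 18, 3 ∣ (t + j * k) % 61 - #((range 18).filter fun i' => (t + j * i') % 61 < (t + j * k) % 61)) →
    j ∈ ({0, 1, 60, 2, 59, 30, 31} : Finset ℕ) := by
  decide +kernel

/-- The word target `{0, ±1, ±2}` at `61` (`a = 2`, `b = 3`): every member is a word ratio. [folklore] -/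
theorem target_61_a2_b3 : ∀ jv ∈ ({0, 1, 60, 2, 59} : Finset ℕ),
    jv = 0 ∨ (∃ k ∈ range 3, 1 ≤ k ∧ (jv = k ∨ jv + k = 61)) ∨ (∃ k ∈ range 2, 1 ≤ k ∧ (jv * k % 61 = 1 ∨ jv * k % 61 = 61 - 1)) := by
  decide

/-- Case-β table `(n+1, m, b) = (43, 18, 3)` at `61`: survivors `30, 31` beyond the words. [folklore] -/
theorem tableB61_43_18_3 : tableBeta 61 43 18 3 ({0, 1, 60, 2, 59, 30, 31} : Finset ℕ) = true := by
  decide +kernel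

end Summit.MatrixMultiplication.OmegaCensus.CubeNB
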